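import Literature.Probability.RandomPlanarGeometry.ConformalRestrictionCovariance
import Literature.Probability.RandomPlanarGeometry.RestrictionPullback
import Literature.Probability.RandomPlanarGeometry.ConformalMapCaratheodoryProofs
import HarnessLib

/-!
# Chordal SLE_κ laws: transport along conformal maps of Dobrushin domains, one-domain reduction

Topic `Probability/RandomPlanarGeometry`; theorems only (no new definition, no named fact), all
unconditional. By-product of the line `isotropy-kills-beltrami` on crux
`CardyRotToConfR2SymmetryUpgrade` (stmt-CriticalPhenomena-0698), where the back-end stub
"Schramm's principle + LSW locality for the typed bundle" reduces to ONE Dobrushin domain by the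
last theorem below.

* `DobrushinDomain.exists_conformalEquiv_continuousMap` — between any two Dobrushin domains
  `(D₀; a₀, b₀)`, `(D; a, b)` there is a conformal equivalence `g : D₀ → D` with boundary values
  `a₀ ↦ a`, `b₀ ↦ b`, together with a continuous map `Φ : ℂ → ℂ` agreeing with `g` on `D₀`
  (chordal uniformizers `MarkedDomain.exists_isChordalUniformizing_holds`; Carathéodory + Tietze
  packaged in the tree as `exists_continuousMap_conj`);
* `IsSLELaw.map_conformal` — the push-forward of a chordal SLE_κ law of `D₀` along such a pair
  `(g, Φ)` is a chordal SLE_κ law of `D` (`IsSLECurve.map`, Carathéodory boundary values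
  `JordanDomain.exists_hasBoundaryValue_holds`);
* `ChordalFamily.IsConformallyCovariant.isSLELaw_of_isSLELaw` — **one-domain reduction**: a
  conformally covariant chordal family (`ChordalFamily.IsConformallyCovariant`) which is the
  chordal SLE_κ law in ONE Dobrushin domain is the chordal SLE_κ law in EVERY Dobrushin domain.

## References

* G. F. Lawler, *Conformally Invariant Processes in the Plane*, AMS (2005), §6.1 p. 149 (chordal
  SLE_κ in a domain is the conformal image of chordal SLE_κ in `ℍ`, independent of the map) and
  §6.3 p. 153.
* Ch. Pommerenke, *Boundary Behaviour of Conformal Maps*, Springer (1992), Thm. 2.6 (Carathéodory).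
-/

noncomputable section

namespace Literature.Probability.RandomPlanarGeometry

open MeasureTheory Set Filter Topology
open scoped ENNReal NNReal unitInterval

/-- **Conformal maps between Dobrushin domains with a continuous plane extension.** For any two
Dobrushin domains `(D₀; a₀, b₀)` and `(D; a, b)` there are a conformal equivalence `g : D₀ → D`
with boundary values `a₀ ↦ a`, `b₀ ↦ b` (limits within `D₀`) and a continuous `Φ : ℂ → ℂ` with
`Φ = g` on `D₀`: take `g = ψ ∘ φ⁻¹` for chordal uniformizing maps `φ : ℍ → D₀`, `ψ : ℍ → D`
(Riemann mapping + Carathéodory); the extension is Carathéodory on `closure D₀` and Tietze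
beyond (`exists_continuousMap_conj`). [cite: Pommerenke1992, Thm. 2.6] -/
theorem DobrushinDomain.exists_conformalEquiv_continuousMap (D₀ D : DobrushinDomain) :
    ∃ (g : ConformalEquiv D₀.carrier D.carrier) (Φ : C(ℂ, ℂ)),
      g.HasBoundaryValue (D₀.pt 0) (D.pt 0) ∧ g.HasBoundaryValue (D₀.pt 1) (D.pt 1) ∧
        EqOn Φ g D₀.carrier := by
  obtain ⟨φ, hφ⟩ := MarkedDomain.exists_isChordalUniformizing_holds D₀
  obtain ⟨ψ, hψ⟩ := MarkedDomain.exists_isChordalUniformizing_holds D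
  obtain ⟨G, hGg, hb0, hb1, -⟩ :=
    exists_continuousMap_conj JordanDomain.exists_continuousOn_extension_holds hφ hψ
  exact ⟨φ.symm.trans ψ, G, hb0, hb1, hGg⟩

/-- **Push-forward of a chordal SLE_κ law along a conformal map of Dobrushin domains.** If `μ` is
a chordal SLE_κ law of `(D₀; a₀, b₀)`, `g : D₀ → D` is a conformal equivalence with boundary
values `a₀ ↦ a`, `b₀ ↦ b` and `Φ : ℂ → ℂ` is continuous with `Φ = g` on `D₀`, then `Φ_* μ` is a
chordal SLE_κ law of `(D; a, b)`: the image of an SLE_κ random curve through the uniformizing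
map `φ` is the SLE_κ random curve through `g ∘ φ` (`IsSLECurve.map`, Carathéodory boundary
values `JordanDomain.exists_hasBoundaryValue_holds`). [cite: Lawler2005, §6.3 p. 153] -/
theorem IsSLELaw.map_conformal {κ : ℝ≥0} {D₀ D : DobrushinDomain} {μ : Measure (CurveClass ℂ)}
    (hμ : IsSLELaw κ D₀ μ) (g : ConformalEquiv D₀.carrier D.carrier) {Φ : C(ℂ, ℂ)}
    (h0 : g.HasBoundaryValue (D₀.pt 0) (D.pt 0)) (h1 : g.HasBoundaryValue (D₀.pt 1) (D.pt 1))
    (hΦ : EqOn Φ g D₀.carrier) : IsSLELaw κ D (μ.map (CurveClass.map Φ)) := by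
  obtain ⟨Γ, hΓ, rfl⟩ := hμ
  rw [AEMeasurable.map_map_of_aemeasurable (CurveClass.measurable_map Φ).aemeasurable
    hΓ.aemeasurable]
  exact (hΓ.map JordanDomain.exists_hasBoundaryValue_holds g h0 h1 hΦ).isSLELaw_map

/-- **One-domain reduction (every `κ`).** A conformally covariant chordal family which is the
chordal SLE_κ law in one Dobrushin domain `D₀` is the chordal SLE_κ law in every Dobrushin
domain `D`: `Q D = Φ_* (Q D₀)` for the conformal map `g : D₀ → D` respecting the marked points
and its continuous plane extension `Φ` (`DobrushinDomain.exists_conformalEquiv_continuousMap`),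
and `Φ_* (Q D₀)` is an SLE_κ law of `D` (`IsSLELaw.map_conformal`). This is the converse
bookkeeping of `ChordalFamily.isConformallyCovariant_of_isSLELaw`. [cite: Lawler2005, §6.1 p. 149] -/
theorem ChordalFamily.IsConformallyCovariant.isSLELaw_of_isSLELaw {κ : ℝ≥0} {Q : ChordalFamily}
    (hcov : Q.IsConformallyCovariant) {D₀ : DobrushinDomain} (hD₀ : IsSLELaw κ D₀ (Q D₀))
    (D : DobrushinDomain) : IsSLELaw κ D (Q D) := by
  obtain ⟨g, Φ, h0, h1, hΦ⟩ := DobrushinDomain.exists_conformalEquiv_continuousMap D₀ D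
  rw [hcov D₀ D g Φ h0 h1 hΦ]
  exact hD₀.map_conformal g h0 h1 hΦ

end Literature.Probability.RandomPlanarGeometry

end
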